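import Summits.AtomisticToContinuum.HydrodynamicLimit.Theorems.JParityClosureLocalSecondLawEquilibriumColdBallsFrozenCases

/-!
# Cold balls at frozen positions, part 3 (lead c3): the frozen-position bound

Stub `eq_coldBalls` (crux `JParityClosure.LocalSecondLaw`, stmt-AtomisticToContinuum-13081, line `exact-entropy-ledger-three-passivities`).
`coldBalls_frozen_shells` (registered sub-goal): for every `N`, positions `xs` and field point `x₀`,
`E_Q[coldStat] ≤ B/(N+1) + B/(2√(N+1))·(S_I(Θ,N) + K(Θ,ū)) + ∑ₘ coldII(B·2^{-(m+1)})·𝟙[∃ k, xs_k ∈ shell m]`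
(case split empty-or-singleton / dominated / spread of parts 1–2; in the dominated case the second weight `β ∈ (B2^{-(m+1)}, B2^{-m}]`
is localised dyadically and `coldII` is antitone).  This is the lead's form of the registered `coldBalls_frozen`, with the
dominated term already majorised by the shell series (so that the assembly integrates it against the uniform one-particle marginal).

References: H. Spohn, *Large Scale Dynamics of Interacting Particles* (1991), Part I §2.3 (homogeneous Gibbs law: configurational
Gibbs measure ⊗ product Maxwellian); S. Goldstein, J. L. Lebowitz, Physica D 193 (2004) 53–66 (typicality of coarse-grained
observables at equilibrium).
-/

noncomputable section

namespace Summit.AtomisticToContinuum.HydrodynamicLimit.Theorems.LocalSecondLawEquilibrium.ColdFrozen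

open scoped BigOperators Topology Classical MeasureTheory ENNReal InnerProductSpace
open Filter Set MeasureTheory ProbabilityTheory
open Literature.MathematicalPhysics.KineticTheory
open Literature.Analysis.FluidPDE
open Summit.AtomisticToContinuum.HydrodynamicLimit.Theorems.LocalSecondLawNegative
open Summit.AtomisticToContinuum.HydrodynamicLimit.Theorems.LocalSecondLawLedger
open Summit.AtomisticToContinuum.HydrodynamicLimit.Theorems.LocalSecondLawLedger.L

variable {N : ℕ}

/-! ## The frozen-position bound -/

/-- **The frozen-position bound** (lead c3's form of the registered `coldBalls_frozen`, with the dominated term already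
majorised by the dyadic shell series): for every `N`, positions `xs` and field point `x₀`,
`E_Q[coldStat] ≤ B/(N+1) + B/(2√(N+1))·(S_I + K) + ∑ₘ coldII(B·2^{-(m+1)})·𝟙[∃ k, xs_k ∈ shell m]`. -/
theorem coldBalls_frozen_shells :
    ∀ {Θ r : ℝ}, 0 < Θ → 0 < r → ∀ (ū : V3) (N : ℕ) (xs : Fin (N + 1) → T3) (x₀ : T3), ∫⁻ vs, ENNReal.ofReal (coldStat Θ r xs x₀ vs) ∂Measure.pi (fun _ : Fin (N + 1) => gaussMeasure ū Θ) ≤ ENNReal.ofReal (3 / (Real.pi * r ^ 3) / ((N + 1 : ℕ) : ℝ)) + ENNReal.ofReal (3 / (Real.pi * r ^ 3) / (2 * Real.sqrt ((N + 1 : ℕ) : ℝ)) * (coldSI Θ N + chebConst Θ ū)) + ∑' m : ℕ, ENNReal.ofReal (coldII Θ r N (3 / (Real.pi * r ^ 3) * (2 : ℝ)⁻¹ ^ (m + 1))) * {xs : Fin (N + 1) → T3 | ∃ k, xs k ∈ {y : T3 | 3 / (Real.pi * r ^ 3) * (2 : ℝ)⁻¹ ^ (m + 1) < cone r y x₀ ∧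 cone r y x₀ ≤ 3 / (Real.pi * r ^ 3) * (2 : ℝ)⁻¹ ^ m}}.indicator 1 xs := by
  intro Θ r hΘ hr ū N xs x₀
  have hB0 : 0 < 3 / (Real.pi * r ^ 3) := by positivity
  by_cases hsub : ∀ i j, i ≠ j → cone r (xs i) x₀ = 0 ∨ cone r (xs j) x₀ = 0
  · -- empty or singleton support
    refine le_trans ?_ (self_le_add_right _ _)
    refine le_trans ?_ (self_le_add_right _ _)
    calc ∫⁻ vs, ENNReal.ofReal (coldStat Θ r xs x₀ vs) ∂Measure.pi (fun _ : Fin (N + 1) => gaussMeasure ū Θ)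
        ≤ ∫⁻ _vs, ENNReal.ofReal (3 / (Real.pi * r ^ 3) / ((N + 1 : ℕ) : ℝ))
            ∂Measure.pi (fun _ : Fin (N + 1) => gaussMeasure ū Θ) :=
          lintegral_mono fun vs => ENNReal.ofReal_le_ofReal (coldStat_le_of_subsingleton hr xs x₀ hsub vs)
      _ = _ := by rw [lintegral_const, measure_univ, mul_one]
  · push Not at hsub
    obtain ⟨i, j, hij, hi, hj⟩ := hsub
    -- the largest and the second largest weight
    obtain ⟨i₁, -, hmax⟩ := Finset.exists_max_image Finset.univ (fun k => cone r (xs k) x₀) Finset.univ_nonempty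
    have hne_erase : (Finset.univ.erase i₁).Nonempty := by
      by_cases h : i = i₁
      · exact ⟨j, Finset.mem_erase.2 ⟨fun h' => hij (h.trans h'.symm), Finset.mem_univ j⟩⟩
      · exact ⟨i, Finset.mem_erase.2 ⟨h, Finset.mem_univ i⟩⟩
    obtain ⟨j₁, hj₁mem, hsec⟩ := Finset.exists_max_image (Finset.univ.erase i₁) (fun k => cone r (xs k) x₀) hne_erase
    have hne : j₁ ≠ i₁ := Finset.ne_of_mem_erase hj₁mem
    have hmax' : ∀ k, cone r (xs k) x₀ ≤ cone r (xs i₁) x₀ := fun k => hmax k (Finset.mem_univ k)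
    have hsec' : ∀ k, k ≠ i₁ → cone r (xs k) x₀ ≤ cone r (xs j₁) x₀ := fun k hk =>
      hsec k (Finset.mem_erase.2 ⟨hk, Finset.mem_univ k⟩)
    have hβ : 0 < cone r (xs j₁) x₀ := by
      by_cases h : i = i₁
      · have hj' : j ≠ i₁ := fun h' => hij (h.trans h'.symm)
        exact lt_of_lt_of_le (lt_of_le_of_ne (cone_nonneg hr _ _) (Ne.symm hj)) (hsec' j hj')
      · exact lt_of_lt_of_le (lt_of_le_of_ne (cone_nonneg hr _ _) (Ne.symm hi)) (hsec' i h)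
    by_cases hdom : ∑ k, cone r (xs k) x₀ < 2 * cone r (xs i₁) x₀
    · -- dominated: through coldII(β) and the dyadic shell of the second particle
      refine le_trans ?_ (le_add_left le_rfl)
      have h1 := lintegral_coldStat_dominated hΘ hr ū xs x₀ hne hmax' hβ hdom
      refine h1.trans ?_
      -- the shell index of β
      have hβB : cone r (xs j₁) x₀ / (3 / (Real.pi * r ^ 3)) ≤ 1 := by
        rw [div_le_one hB0]; exact cone_le_const hr _ _
      obtain ⟨m, hm1, hm2⟩ := exists_dyadic (by positivity : 0 < cone r (xs j₁) x₀ / (3 / (Real.pi * r ^ 3))) hβB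
      have hm1' : 3 / (Real.pi * r ^ 3) * (2 : ℝ)⁻¹ ^ (m + 1) < cone r (xs j₁) x₀ := by
        rw [lt_div_iff₀ hB0] at hm1; linarith
      have hm2' : cone r (xs j₁) x₀ ≤ 3 / (Real.pi * r ^ 3) * (2 : ℝ)⁻¹ ^ m := by
        rw [div_le_iff₀ hB0] at hm2; linarith
      refine le_trans ?_ (ENNReal.le_tsum m)
      have hmem : xs ∈ {xs : Fin (N + 1) → T3 | ∃ k, xs k ∈ {y : T3 | 3 / (Real.pi * r ^ 3) * (2 : ℝ)⁻¹ ^ (m + 1) <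
          cone r y x₀ ∧ cone r y x₀ ≤ 3 / (Real.pi * r ^ 3) * (2 : ℝ)⁻¹ ^ m}} := ⟨j₁, hm1', hm2'⟩
      rw [Set.indicator_of_mem hmem, Pi.one_apply, mul_one]
      exact ENNReal.ofReal_le_ofReal (coldII_antitone hΘ hr N (by positivity) hm1'.le)
    · -- spread
      push Not at hdom
      refine le_trans ?_ (self_le_add_right _ _)
      refine le_trans ?_ (le_add_left le_rfl)
      exact lintegral_coldStat_spread hΘ hr ū xs x₀ hne hmax' hsec' hβ hdom


end Summit.AtomisticToContinuum.HydrodynamicLimit.Theorems.LocalSecondLawEquilibrium.ColdFrozen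

end
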